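import Summits.CriticalPhenomena.PercolationContinuityZ3.Theorems.Transplant.CayleySkeletonFrmFrom
import Mathlib.GroupTheory.SemidirectProduct
import Mathlib.Data.Int.Cast.Lemmas
import Mathlib.Tactic.FinCases
import HarnessLib

/-!
# A KERNEL (κ′)-GENUINE ONE-TYPE WITNESS: the class-4 filiform group `Q = ℤ⁴ ⋊_J ℤ` (`J` a unipotent Jordan block) with the letters alphabet
# `{a^{±1}, b^{±1}}` is a customer of the universal one-type node U (`CayleyFrm₃`), and the UNIT CYLINDER of its letters chart is DISCONNECTED

builds on p205010 (kernel theorem, internal audit signed; external expert review pending) — nothing in this file uses p205010; NOTHING is claimed about any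
open node: `θ(p_c) = 0` on `Cay(Q; a^{±1}, b^{±1})` is stated only MODULO the OPEN node U = `SamePDropOfSkeletonFrmFrom₁` (`criticalContinuity_of_frmFromNode₁`).
Lane `prim-bschramm`, seat `prim-bschramm-p5` gen 24 (refuter / sharpness seat; the OPTIONAL class-B certificate of RULING A-U-VAC, lead g21 2026-08-26 11:40Z:
"a kernel ¬(κ)-at-width-1 certificate for ONE concrete class-4 letters-type group is welcome"; P5-SHARPNESS §54.10).  Helper file
(`--supports stmt-CriticalPhenomena-4575 --as helper`).
THE GROUP.  `Q := Lat ⋊[act] Rot` with `Lat = ℤ⁴` (multiplicative), `Rot = ℤ`, `act k = J^k` where `J v = (v₀, v₀+v₁, v₁+v₂, v₂+v₃)` (so `J eᵢ = eᵢ + eᵢ₊₁`,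
`(J − 1)⁴ = 0 ≠ (J − 1)³`: `Q` is nilpotent of class EXACTLY 4, two-generated by `a = (0, 1)` and `b = (e₀, 0)` — the standard filiform group of class 4).
THE CHART.  `φ (v, k) = (k, v₀)` — additive (every power of `J` fixes the coordinate `v₀`), of unit range on `S = {a, a⁻¹, b, b⁻¹}`, with unit steps `a ↦ e₀`,
`b ↦ e₁`; `S` generates `Q` (`a b a⁻¹ b⁻¹ = (e₁, 0)` and so on up the flag) and `ker φ = {(v, 0) : v₀ = 0}` is generated by `(e₁,0), (e₂,0), (e₃,0)` ⟹
**`Filiform.cayleyFrm₃ : CayleyFrm₃ Q S`** (p4's U-customer input: additive unit-range chart, unit steps, finitely generated kernel — NO automorphism, NO cylinder hypothesis)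
⟹ `θ_g(p_c) = 0` on `Cay(Q; S)` MODULO U (`Filiform.criticalContinuity_of_frmFromNode₁`).
THE CERTIFICATE.  `f (v, k) := v₂ + v₃` is constant along every edge of `Cay(Q; S)` whose endpoints lie in the unit cylinder `C₁ = {|k| ≤ 1, |v₀| ≤ 1}`
(right multiplication by `a^{±1}` does not move `v`; by `b^{±1}` it adds `±J^k e₀ ∈ {e₀, e₀+e₁, e₀−e₁+e₂−e₃}` for `k ∈ {0, 1, −1}`, each with `v₂ + v₃ = 0`), while
`f (e₂, 0) = 1 ≠ 0 = f 1` with both in `C₁` ⟹ **`Filiform.not_connected_unitCyl` : the subgraph induced on `C₁` is NOT connected** — (κ) FAILS at width 1 for this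
chart, so this U-customer is NOT an N2-customer through its letters chart (and every additive unit-step chart of `Q` has the same cylinders up to the symmetries of the
box).  The R-level statement for the free nilpotent groups `N_{m,c}`, `c ≥ 4`, is P4-GENERAL §33.1/§35.2 (GAP j157698); this file is the first kernel instance.
[cite: BenjaminiSchramm1996, Conj. 4; §2 (Cayley graphs)] [cite: KozmaNitzan2024, §4 p. 15 (boxes), p. 16 (Lemma 8)] [cite: MartineauTassion2017, §3.2]
-/

noncomputable section

namespace Summit.CriticalPhenomena.PercolationContinuityZ3.Theorems.Transplant

open SimpleGraph Literature.Probability.LatticeModels Literature.Probability.Percolation Multiplicative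

namespace Filiform

/-! ## §1 The lattice `ℤ⁴`, the Jordan block `J`, the action, the group `Q` -/

/-- The lattice `ℤ⁴`, written multiplicatively. [folklore] -/
abbrev Lat : Type := Multiplicative (Fin 4 → ℤ)

/-- The acting group `ℤ`, written multiplicatively. [folklore] -/
abbrev Rot : Type := Multiplicative ℤ

/-- The unipotent Jordan block `J v = (v₀, v₀ + v₁, v₁ + v₂, v₂ + v₃)`. [folklore] -/
def jmap (v : Fin 4 → ℤ) : Fin 4 → ℤ := ![v 0, v 0 + v 1, v 1 + v 2, v 2 + v 3]

/-- Its inverse `J⁻¹ w = (w₀, w₁ − w₀, w₂ − w₁ + w₀, w₃ − w₂ + w₁ − w₀)`. [folklore] -/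
def jinv (w : Fin 4 → ℤ) : Fin 4 → ℤ := ![w 0, w 1 - w 0, w 2 - w 1 + w 0, w 3 - w 2 + w 1 - w 0]

/-- `J⁻¹ ∘ J = id`. [folklore] -/
theorem jinv_jmap (v : Fin 4 → ℤ) : jinv (jmap v) = v := by
  ext i; fin_cases i <;> simp [jmap, jinv] <;> ring

/-- `J ∘ J⁻¹ = id`. [folklore] -/
theorem jmap_jinv (w : Fin 4 → ℤ) : jmap (jinv w) = w := by
  ext i; fin_cases i <;> simp [jmap, jinv]

/-- `J` is additive. [folklore] -/
theorem jmap_add (v w : Fin 4 → ℤ) : jmap (v + w) = jmap v + jmap w := by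
  ext i; fin_cases i <;> simp [jmap] <;> ring

/-- **`J` as a multiplicative automorphism of `ℤ⁴`.** [folklore] -/
def J : MulAut Lat where
  toFun v := ofAdd (jmap (toAdd v))
  invFun w := ofAdd (jinv (toAdd w))
  left_inv v := by apply toAdd.injective; simp [jinv_jmap]
  right_inv w := by apply toAdd.injective; simp [jmap_jinv]
  map_mul' v w := by apply toAdd.injective; simp [jmap_add]

/-- `J` unfolded. [folklore] -/
@[simp] theorem toAdd_J (v : Lat) : toAdd (J v) = jmap (toAdd v) := rfl

/-- `J⁻¹` unfolded. [folklore] -/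
@[simp] theorem toAdd_J_symm (w : Lat) : toAdd (J.symm w) = jinv (toAdd w) := rfl

/-- **The action `k ↦ J^k` of `ℤ` on `ℤ⁴`.** [folklore] -/
def act : Rot →* MulAut Lat := zpowersHom (MulAut Lat) J

/-- The action is `k ↦ J^k`. [folklore] -/
theorem act_apply (g : Rot) : act g = J ^ (toAdd g) := rfl

/-- Every power of `J` fixes the first coordinate. [folklore] -/
theorem toAdd_act_apply_zero (g : Rot) (v : Lat) : toAdd (act g v) 0 = toAdd v 0 := by
  rw [act_apply]
  induction toAdd g using Int.induction_on generalizing v with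
  | zero => simp
  | succ k ih =>
    rw [zpow_add_one, MulAut.mul_apply, ih]
    simp [jmap]
  | pred k ih =>
    rw [zpow_sub_one, MulAut.mul_apply, ih, MulAut.inv_apply, toAdd_J_symm]
    simp [jinv]

/-- **The filiform group `Q = ℤ⁴ ⋊_J ℤ`** (nilpotent of class 4, generated by `a = (0,1)` and `b = (e₀,0)`). [folklore] -/
abbrev Q : Type := Lat ⋊[act] Rot

/-- The letter `a = (0, 1)`. [folklore] -/
def a : Q := SemidirectProduct.inr (ofAdd (1 : ℤ))

/-- The lattice vector `eᵢ`. [folklore] -/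
def e (i : Fin 4) : Fin 4 → ℤ := Pi.single i 1

/-- The lattice element `(v, 0)`. [folklore] -/
def lat (v : Fin 4 → ℤ) : Q := SemidirectProduct.inl (ofAdd v)

/-- The letter `b = (e₀, 0)`. [folklore] -/
def b : Q := lat (e 0)

/-- **The letters alphabet `S = {a, a⁻¹, b, b⁻¹}`.** [folklore] -/
def S : Finset Q := {a, a⁻¹, b, b⁻¹}

/-! ## §2 The chart `φ (v, k) = (k, v₀)` -/

/-- **The letters chart** `φ (v, k) = (k, v₀)`. [cite: KozmaNitzan2024, §4 p. 16 (Lemma 8)] -/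
def φ (x : Q) : Site 2 := ![toAdd x.right, toAdd x.left 0]

/-- First chart coordinate: the `a`-exponent. [folklore] -/
@[simp] theorem φ_apply_zero (x : Q) : φ x 0 = toAdd x.right := rfl

/-- Second chart coordinate: the `e₀`-coefficient. [folklore] -/
@[simp] theorem φ_apply_one (x : Q) : φ x 1 = toAdd x.left 0 := rfl

/-- The chart is additive. [folklore] -/
theorem φ_mul (x y : Q) : φ (x * y) = φ x + φ y := by
  ext i
  fin_cases i
  · simp [φ, SemidirectProduct.mul_right]
  · simp [φ, SemidirectProduct.mul_left, toAdd_act_apply_zero]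

/-- `φ a = e₀`. [folklore] -/
theorem φ_a : φ a = Pi.single 0 1 := by
  ext i; fin_cases i <;> simp [φ, a]

/-- `φ b = e₁`. [folklore] -/
theorem φ_b : φ b = Pi.single 1 1 := by
  ext i; fin_cases i <;> simp [φ, b, lat, e]

/-- `φ 1 = 0`. [folklore] -/
theorem φ_one : φ 1 = 0 := by
  ext i; fin_cases i <;> simp [φ]

/-- `φ x⁻¹ = −φ x`. [folklore] -/
theorem φ_inv (x : Q) : φ x⁻¹ = -φ x := by
  have h := φ_mul x⁻¹ x
  rw [inv_mul_cancel, φ_one] at h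
  exact eq_neg_of_add_eq_zero_left h.symm

/-- Unit range on `S`. [folklore] -/
theorem lip : ∀ s ∈ S, ∀ i : Fin 2, |φ s i| ≤ 1 := by
  intro s hs i
  simp only [S, Finset.mem_insert, Finset.mem_singleton] at hs
  rcases hs with rfl | rfl | rfl | rfl
  · rw [φ_a]; fin_cases i <;> simp
  · rw [φ_inv, φ_a]; fin_cases i <;> simp
  · rw [φ_b]; fin_cases i <;> simp
  · rw [φ_inv, φ_b]; fin_cases i <;> simp

/-- Unit steps in `S`. [folklore] -/
theorem step : ∀ i : Fin 2, ∃ s ∈ S, φ s = Pi.single i 1 := by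
  intro i
  fin_cases i
  · exact ⟨a, by simp [S], φ_a⟩
  · exact ⟨b, by simp [S], φ_b⟩

/-! ## §3 `S` generates `Q`; the kernel of the chart is generated by `(e₁,0), (e₂,0), (e₃,0)` -/

/-- `lat` is a homomorphism from `ℤ⁴`. [folklore] -/
theorem lat_add (v w : Fin 4 → ℤ) : lat (v + w) = lat v * lat w := by
  simp [lat, ofAdd_add]

/-- `lat 0 = 1`. [folklore] -/
theorem lat_zero : lat 0 = 1 := by simp [lat]

/-- `lat (−v) = (lat v)⁻¹`. [folklore] -/
theorem lat_neg (v : Fin 4 → ℤ) : lat (-v) = (lat v)⁻¹ := by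
  simp [lat, ofAdd_neg]

/-- `lat (n • v) = (lat v)^n`. [folklore] -/
theorem lat_zsmul (n : ℤ) (v : Fin 4 → ℤ) : lat (n • v) = lat v ^ n := by
  rw [lat, lat, ofAdd_zsmul, map_zpow]

/-- **Conjugation by `a` is `J`**: `a · (v,0) · a⁻¹ = (J v, 0)`. [folklore] -/
theorem conj_lat (v : Fin 4 → ℤ) : a * lat v * a⁻¹ = lat (jmap v) := by
  refine SemidirectProduct.ext ?_ ?_
  · apply toAdd.injective
    simp [a, lat, SemidirectProduct.mul_left, SemidirectProduct.inv_left, act_apply]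
  · simp [a, lat, SemidirectProduct.mul_right, SemidirectProduct.inv_right]

/-- The commutator `[a, (eᵢ,0)] = (J eᵢ − eᵢ, 0)`. [folklore] -/
theorem comm_lat (v : Fin 4 → ℤ) : a * lat v * a⁻¹ * (lat v)⁻¹ = lat (jmap v - v) := by
  rw [conj_lat, sub_eq_add_neg, lat_add, lat_neg]

/-- `J eᵢ − eᵢ = eᵢ₊₁` for `i < 3`. [folklore] -/
theorem jmap_e_sub (i : Fin 4) (hi : i ≠ 3) : jmap (e i) - e i = e (i + 1) := by
  fin_cases i <;> first | (exfalso; exact hi rfl) | (ext j; fin_cases j <;> simp [jmap, e])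

/-- All lattice basis vectors lie in the subgroup generated by `S`. [folklore] -/
theorem lat_e_mem_closure (i : Fin 4) : lat (e i) ∈ Subgroup.closure (S : Set Q) := by
  have ha : a ∈ Subgroup.closure (S : Set Q) := Subgroup.subset_closure (by simp [S])
  have hb : lat (e 0) ∈ Subgroup.closure (S : Set Q) := Subgroup.subset_closure (by simp [S, b])
  have hstep : ∀ j : Fin 4, j ≠ 3 → lat (e j) ∈ Subgroup.closure (S : Set Q) → lat (e (j + 1)) ∈ Subgroup.closure (S : Set Q) := by
    intro j hj h
    rw [← jmap_e_sub j hj, ← comm_lat]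
    exact Subgroup.mul_mem _ (Subgroup.mul_mem _ (Subgroup.mul_mem _ ha h) (Subgroup.inv_mem _ ha)) (Subgroup.inv_mem _ h)
  have h1 := hstep 0 (by decide) hb
  have h2 := hstep 1 (by decide) h1
  have h3 := hstep 2 (by decide) h2
  fin_cases i
  · exact hb
  · exact h1
  · exact h2
  · exact h3

/-- Every lattice element lies in a subgroup containing the basis vectors. [folklore] -/
theorem lat_mem_of_basis (H : Subgroup Q) (hH : ∀ i, lat (e i) ∈ H) (v : Fin 4 → ℤ) : lat v ∈ H := by
  have hv : v = ∑ i, v i • e i := by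
    ext j; simp [e, Finset.sum_apply, Pi.single_apply]
  rw [hv]
  induction (Finset.univ : Finset (Fin 4)) using Finset.induction_on with
  | empty => rw [Finset.sum_empty, lat_zero]; exact H.one_mem
  | insert i s hi ih =>
    rw [Finset.sum_insert hi, lat_add, lat_zsmul]
    exact H.mul_mem (H.zpow_mem (hH i) _) ih

/-- Every element is `(v,0) · a^k`. [folklore] -/
theorem eq_lat_mul_zpow (x : Q) : x = lat (toAdd x.left) * a ^ (toAdd x.right) := by
  have h := SemidirectProduct.mk_eq_inl_mul_inr (φ := act) x.right x.left
  have ha : a ^ (toAdd x.right) = SemidirectProduct.inr x.right := by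
    rw [a, ← map_zpow, ← ofAdd_zsmul, smul_eq_mul, mul_one, ofAdd_toAdd]
  rw [ha, lat, ofAdd_toAdd, ← h]

/-- **`S` generates `Q`.** [folklore] -/
theorem closure_S : Subgroup.closure (S : Set Q) = ⊤ := by
  rw [eq_top_iff]
  intro x _
  rw [eq_lat_mul_zpow x]
  exact Subgroup.mul_mem _ (lat_mem_of_basis _ lat_e_mem_closure _)
    (Subgroup.zpow_mem _ (Subgroup.subset_closure (by simp [S])) _)

/-- The kernel generators `(e₁,0), (e₂,0), (e₃,0)`. [folklore] -/
def T : Finset Q := {lat (e 1), lat (e 2), lat (e 3)}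

/-- The chart of a lattice element. [folklore] -/
theorem φ_lat (v : Fin 4 → ℤ) : φ (lat v) = ![0, v 0] := by
  ext i; fin_cases i <;> simp [φ, lat]

/-- `T ⊆ ker φ`. [folklore] -/
theorem T_ker : ∀ t ∈ T, φ t = 0 := by
  intro t ht
  simp only [T, Finset.mem_insert, Finset.mem_singleton] at ht
  rcases ht with rfl | rfl | rfl <;> (rw [φ_lat]; ext i; fin_cases i <;> simp [e])

/-- **The kernel of the chart is generated by `T`.** [folklore] -/
theorem ker_le_closure_T (x : Q) (hx : φ x = 0) : x ∈ Subgroup.closure (T : Set Q) := by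
  have h0 : toAdd x.right = 0 := by simpa using congrFun hx 0
  have h1 : toAdd x.left 0 = 0 := by simpa using congrFun hx 1
  rw [eq_lat_mul_zpow x, h0, zpow_zero, mul_one]
  set v := toAdd x.left with hv
  have hdec : v = ∑ i ∈ ({1, 2, 3} : Finset (Fin 4)), v i • e i := by
    ext j; fin_cases j <;> simp [e, Finset.sum_apply, Pi.single_apply, h1]
  rw [hdec, Finset.sum_insert (by decide), Finset.sum_insert (by decide), Finset.sum_singleton, lat_add, lat_add, lat_zsmul, lat_zsmul,
    lat_zsmul]
  have hm : ∀ i ∈ ({1, 2, 3} : Finset (Fin 4)), lat (e i) ∈ Subgroup.closure (T : Set Q) := by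
    intro i hi
    apply Subgroup.subset_closure
    simp only [Finset.mem_insert, Finset.mem_singleton] at hi
    rcases hi with rfl | rfl | rfl <;> simp [T]
  exact Subgroup.mul_mem _ (Subgroup.zpow_mem _ (hm 1 (by simp)) _)
    (Subgroup.mul_mem _ (Subgroup.zpow_mem _ (hm 2 (by simp)) _) (Subgroup.zpow_mem _ (hm 3 (by simp)) _))

/-- **`Q` WITH ITS LETTERS ALPHABET IS A U-CUSTOMER** (`CayleyFrm₃`: additive unit-range chart with unit steps and finitely generated kernel; NO automorphism, NO
cylinder hypothesis — the width `ℓ₀` is derived by p4's `CayleyFrm₃.skeletonFrmFrom`). [cite: BenjaminiSchramm1996, §2 (Cayley graphs)] [cite: KozmaNitzan2024, §4 p. 16] -/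
def cayleyFrm₃ : CayleyFrm₃ Q S := CayleyFrm₃.ofGens φ φ_mul lip step closure_S T T_ker ker_le_closure_T

/-- **`θ_g(p_c) = 0` on `Cay(Q; a^{±1}, b^{±1})` MODULO the open node U** (nothing unconditional claimed). [cite: BenjaminiSchramm1996, Conj. 4] -/
theorem criticalContinuity_of_frmFromNode₁ (hN : SamePDropOfSkeletonFrmFrom₁) (g : Q) :
    theta (mulCayley (↑S : Set Q)) g (criticalProbIOf (mulCayley (↑S : Set Q)) g) = 0 :=
  cayleyFrm₃.criticalContinuity_of_frmFromNode₁ hN g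

/-! ## §4 THE CERTIFICATE: the unit cylinder of the letters chart is disconnected -/

/-- **The unit cylinder** `C₁ = {x : φ x ∈ Λ₁} = {(v,k) : |k| ≤ 1, |v₀| ≤ 1}` (= `cyl 1 1` of the skeleton, since `φ 1 = 0`). [cite: KozmaNitzan2024, §4 p. 15 (boxes)] -/
def unitCyl : Set Q := {x | φ x ∈ box 2 1}

/-- Membership in the unit cylinder. [folklore] -/
theorem mem_unitCyl {x : Q} : x ∈ unitCyl ↔ |toAdd x.right| ≤ 1 ∧ |toAdd x.left 0| ≤ 1 := by
  rw [unitCyl, Set.mem_setOf_eq, mem_box, Fin.forall_fin_two, φ_apply_zero, φ_apply_one, abs_le, abs_le]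
  push_cast
  exact Iff.rfl

/-- **The invariant** `f (v, k) = v₂ + v₃`. [this work] -/
def f (x : Q) : ℤ := toAdd x.left 2 + toAdd x.left 3

/-- `f 1 = 0`. [folklore] -/
theorem f_one : f 1 = 0 := by simp [f]

/-- `f (e₂, 0) = 1`. [folklore] -/
theorem f_lat_e_two : f (lat (e 2)) = 1 := by simp [f, lat, e]

/-- `(e₂, 0)` lies in the unit cylinder. [folklore] -/
theorem lat_e_two_mem : lat (e 2) ∈ unitCyl := by
  rw [mem_unitCyl]; simp [lat, e]

/-- `1` lies in the unit cylinder. [folklore] -/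
theorem one_mem : (1 : Q) ∈ unitCyl := by
  rw [mem_unitCyl]; simp

/-- Right multiplication by `a^{±1}` does not move the lattice part. [folklore] -/
theorem f_mul_a (x : Q) : f (x * a) = f x ∧ f (x * a⁻¹) = f x := by
  constructor <;> simp [f, a, SemidirectProduct.mul_left, SemidirectProduct.inv_left]

/-- The three vectors `J^k e₀`, `k ∈ {0, 1, −1}`, added by a `b`-move inside the unit cylinder; each has `v₂ + v₃ = 0`. [this work] -/
theorem toAdd_act_e_zero {k : ℤ} (hk : |k| ≤ 1) :
    toAdd (act (ofAdd k) (ofAdd (e 0))) 2 + toAdd (act (ofAdd k) (ofAdd (e 0))) 3 = 0 := by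
  rw [abs_le] at hk
  have hk' : k = 0 ∨ k = 1 ∨ k = -1 := by omega
  rw [act_apply, toAdd_ofAdd]
  rcases hk' with rfl | rfl | rfl
  · simp [e]
  · simp [e, jmap]
  · rw [zpow_neg, zpow_one, MulAut.inv_apply, toAdd_J_symm]
    simp [e, jinv]

/-- Right multiplication by `b^{±1}` INSIDE the unit cylinder preserves `f`. [this work] -/
theorem f_mul_b {x : Q} (hx : x ∈ unitCyl) : f (x * b) = f x ∧ f (x * b⁻¹) = f x := by
  rw [mem_unitCyl] at hx
  have h := toAdd_act_e_zero hx.1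
  rw [ofAdd_toAdd] at h
  constructor
  · simp only [f, b, lat, SemidirectProduct.mul_left, SemidirectProduct.left_inl, toAdd_mul, Pi.add_apply]
    linarith
  · simp only [f, b, lat, SemidirectProduct.mul_left, SemidirectProduct.inv_left, SemidirectProduct.left_inl, SemidirectProduct.right_inl,
      inv_one, map_one, MulAut.one_apply, map_inv, toAdd_mul, toAdd_inv, Pi.add_apply, Pi.neg_apply]
    linarith

/-- **`f` is constant along every edge of `Cay(Q; S)` leaving a vertex of the unit cylinder.** [this work] -/
theorem f_eq_of_adj {x y : Q} (hx : x ∈ unitCyl) (hy : y ∈ unitCyl) (h : (mulCayley (↑S : Set Q)).Adj x y) : f x = f y := by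
  rw [mulCayley_adj] at h
  obtain ⟨-, h | h⟩ := h
  · -- `y = x * s`
    have e1 : y = x * (x⁻¹ * y) := by group
    simp only [S, Finset.coe_insert, Finset.coe_singleton, Set.mem_insert_iff, Set.mem_singleton_iff] at h
    rcases h with h | h | h | h <;> rw [e1, h]
    · exact (f_mul_a x).1.symm
    · exact (f_mul_a x).2.symm
    · exact (f_mul_b hx).1.symm
    · exact (f_mul_b hx).2.symm
  · -- `x = y * s`
    have e1 : x = y * (y⁻¹ * x) := by group
    simp only [S, Finset.coe_insert, Finset.coe_singleton, Set.mem_insert_iff, Set.mem_singleton_iff] at h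
    rcases h with h | h | h | h <;> rw [e1, h]
    · exact (f_mul_a y).1
    · exact (f_mul_a y).2
    · exact (f_mul_b hy).1
    · exact (f_mul_b hy).2

/-- `f` is constant along walks of the induced unit-cylinder graph. [folklore] -/
theorem f_eq_of_walk {x y : unitCyl} (w : ((mulCayley (↑S : Set Q)).induce unitCyl).Walk x y) : f x.1 = f y.1 := by
  induction w with
  | nil => rfl
  | @cons u v _ h _ ih => exact (f_eq_of_adj u.2 v.2 h).trans ih

/-- **THE CERTIFICATE: the unit cylinder of the letters chart of `Q` induces a DISCONNECTED subgraph of `Cay(Q; a^{±1}, b^{±1})`** — (κ) fails at width 1,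
so `Q` (a U-customer, §3) is NOT an N2-customer through this chart. [cite: KozmaNitzan2024, §4 p. 15 (boxes: connected induced cylinders)] -/
theorem not_connected_unitCyl : ¬ ((mulCayley (↑S : Set Q)).induce unitCyl).Connected := by
  intro hc
  obtain ⟨w⟩ := hc.preconnected ⟨1, one_mem⟩ ⟨lat (e 2), lat_e_two_mem⟩
  have h := f_eq_of_walk w
  rw [f_one, f_lat_e_two] at h
  exact absurd h (by decide)

/-- **Corollary: the p4 skeleton `cayleyFrm₃.skeletonFrmFrom` of this U-customer has `ℓ₀ ≥ 2` forced** — its width-1 cylinder at the base vertex `1` is the disconnected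
`unitCyl`. [cite: KozmaNitzan2024, §4 p. 15] -/
theorem not_connected_cyl_one : ¬ ((mulCayley (↑S : Set Q)).induce {w | φ w - φ 1 ∈ box 2 1}).Connected := by
  have e1 : {w : Q | φ w - φ 1 ∈ box 2 1} = unitCyl := by
    ext w; rw [Set.mem_setOf_eq, φ_one, sub_zero]; rfl
  rw [e1]; exact not_connected_unitCyl

end Filiform

end Summit.CriticalPhenomena.PercolationContinuityZ3.Theorems.Transplant

end
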